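import Summits.ResolutionOfSingularities.ResolutionOfSingularities.Theorems.FrobeniusClosingSteerJacobianCriterionFormal
import Summits.ResolutionOfSingularities.ResolutionOfSingularities.Theorems.FrobeniusClosingSteerRadicandIsolatedAscent
import Mathlib.RingTheory.AdicCompletion.LocalRing
import Mathlib.Data.ZMod.Basic
import Literature.AlgebraicGeometry.Resolution.FormalFibresRegularProofs
import Literature.AlgebraicGeometry.Resolution.AdicCompletionRegular
import HarnessLib

/-!
# Crux `Steer` (stmt-ResolutionOfSingularities-16345), chain W4.1, K-side R3c part 3: THE COHEN FRAME OF A K(3) MEMBER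
# (`S ↦ (K⟦X₁…X_d⟧, p-basis-dual frame of size e, φ f̂)` with the Jacobian ideal `𝔪`-primary; Theses-free, definition-free)

OURS (campaign `res-hironaka`, rung L ★L-G4, slot W4.1; seat res-D-pv-004 AS res-L0-w41-stub-10; replaces the role of
no printed item and is NOT a statement of the manuscript under review [claim: Hironaka2017, status: under-review];
AI-produced, weaker than expert review). Third and last piece of R3c of `D/res-D-pv-004/K3-SCOPING.md`, assembling
p511731 (`JacobianCriterionFormal`), p513029 (`RadicandAscent`) and the tree's Cohen structure theorem: a member `S m` of a
K(3) chain (`NoEternalIsolatedRadicandChainFinrank p 3 1`: regular EXCELLENT local, residue `p`-rank `e`, radicand with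
isolated torsor germ) is handed to the K-side tower in Cohen coordinates with its Jacobian ideal `𝔪`-primary.

* `exists_frame_card` — `[κ : κ^p] = p^e` ⇒ a `p`-basis `γ : Fin e → κ` with dual derivations, of the PINNED size `e`
  (res-L0-w41-stub-3's `PBasisDual.finrank_eq_pow_card_of_isPFree`); `exists_frame_of_ringEquiv` — transport along
  `κ ≃+* K`.
* `isolated_of_ringEquiv` — isolatedness of `A[T]/(T^p − a)` is invariant under `A ≃+* A'` (Mathlib
  `AdjoinRoot.mapRingEquiv`, tree `mem_regularLocus_iff_of_ringEquiv`).
* `charP_adicCompletion`, `charP_residueField`, `isField_range_castHom` (`𝔽_p ⊆ Ŝ` is a coefficient subfield).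
* **`exists_cohenFrame`** — for a regular local G-ring `S` of characteristic `p` with `[κ(S) : κ(S)^p] = p^e` and a radicand
  `f` with isolated torsor germ: `∃ φ : Ŝ ≃+* K⟦X₁, …, X_d⟧` (`K = κ(Ŝ)`, `d = μ(𝔪Ŝ)`; Matsumura 29.7, tree
  `exists_ringEquiv_mvPowerSeries_residueField`), `∃` a dual frame `(γ, D)` of size `e` on `K`, such that for every
  non-maximal prime `Q` of `K⟦X⟧` some `∂(φ f̂)/∂X_i ∉ Q` or some `D̃_l (φ f̂) ∉ Q`.
* `spanFinrank_maximalIdeal_adicCompletion_eq` — `d = dim S`.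

[cite: Matsumura1987, Thm. 29.7; Thm. 30.10; §32 p. 256] bears_on: LADDER-RESOLUTION L ★L-G4 W4.1 (crux `Steer`, K(3) / R3c).
-/

noncomputable section

set_option linter.dupNamespace false

open IsLocalRing Polynomial

namespace Summit.ResolutionOfSingularities.ResolutionOfSingularities.Theorems.SwitchingDichotomy.RadicandCohenFrame

open Literature.AlgebraicGeometry.Resolution Literature.RingTheory.Derivation Literature.FieldTheory.Separability

universe u

/-! ## §1 `p`-basis-dual frames: pinned size, transport along field isomorphisms -/

section Frame

variable (p : ℕ) [Fact p.Prime]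

/-- **A frame of the PINNED size `e`**: if `[κ : κ^p] = p ^ e` then `κ` has a `p`-basis `γ : Fin e → κ` with dual derivations
(res-L0-w41-stub-3's `PBasisDual`: a `p`-free `κ^p`-generating finite set has `p ^ #S = [κ : κ^p]`). [cite: Matsumura1987, §26 p. 202] -/
theorem exists_frame_card {κ : Type u} [Field κ] [CharP κ p] {e : ℕ}
    (he : Module.finrank (frobenius κ p).fieldRange κ = p ^ e) :
    ∃ (γ : Fin e → κ) (D : Fin e → Derivation ℤ κ κ),
      (∀ l l', D l (γ l') = if l' = l then 1 else 0) ∧ pAdjoin p (Set.range γ) = ⊤ := by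
  classical
  have hp : p.Prime := Fact.out
  haveI : Module.Finite (frobenius κ p).fieldRange κ :=
    Module.finite_of_finrank_pos (by rw [he]; exact pow_pos hp.pos e)
  obtain ⟨T, hT⟩ := Module.Finite.fg_top (R := (frobenius κ p).fieldRange) (M := κ)
  have hTtop := PBasisDual.pAdjoin_eq_top_of_span_eq_top p hT
  obtain ⟨S, -, hS, hTS⟩ := exists_isPFree_subset (p := p) T
  have hStop : pAdjoin p (↑S : Set κ) = ⊤ := PBasisDual.pAdjoin_eq_top_of_subset p hTtop hTS
  have hcard : S.card = e :=
    Nat.pow_right_injective hp.two_le ((PBasisDual.finrank_eq_pow_card_of_isPFree p hS hStop).symm.trans he)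
  obtain ⟨δ, hδ⟩ := exists_dual_derivation hS
  let ι : Fin e ≃ S := (S.equivFinOfCardEq hcard).symm
  refine ⟨fun l => (ι l : κ), fun l => δ (ι l : κ), fun l l' => ?_, ?_⟩
  · obtain ⟨h1, h0⟩ := hδ _ (ι l).2
    by_cases hll : l' = l
    · rw [if_pos hll, hll]; exact h1
    · rw [if_neg hll]
      exact h0 _ (ι l').2 fun h => hll (ι.injective (Subtype.ext h))
  · have hrange : Set.range (fun l : Fin e => ((ι l : S) : κ)) = (↑S : Set κ) := by
      ext x
      constructor
      · rintro ⟨l, rfl⟩; exact (ι l).2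
      · intro hx; exact ⟨ι.symm ⟨x, hx⟩, by simp⟩
    rw [hrange, hStop]

/-- **Transport of a dual frame along a field isomorphism** `φ : κ ≃+* K`: `γ' = φ ∘ γ`, `D' = φ ∘ D ∘ φ⁻¹`. [folklore] -/
theorem exists_frame_of_ringEquiv {κ K : Type u} [Field κ] [Field K] [CharP κ p] [CharP K p] (φ : κ ≃+* K)
    {e : ℕ} (γ : Fin e → κ) (D : Fin e → Derivation ℤ κ κ)
    (hdual : ∀ l l', D l (γ l') = if l' = l then 1 else 0) (hgen : pAdjoin p (Set.range γ) = ⊤) :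
    ∃ (γ' : Fin e → K) (D' : Fin e → Derivation ℤ K K),
      (∀ l l', D' l (γ' l') = if l' = l then 1 else 0) ∧ pAdjoin p (Set.range γ') = ⊤ := by
  haveI : ExpChar κ p := ExpChar.prime Fact.out
  haveI : ExpChar K p := ExpChar.prime Fact.out
  let ψ : Fin e → K →ₗ[ℤ] K := fun l =>
    (φ.toAddMonoidHom.comp ((D l).toLinearMap.toAddMonoidHom.comp φ.symm.toAddMonoidHom)).toIntLinearMap
  have hψ : ∀ l x, ψ l x = φ (D l (φ.symm x)) := fun _ _ => rfl
  let D' : Fin e → Derivation ℤ K K := fun l =>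
    Derivation.mk' (ψ l) fun x y => by
      rw [hψ, hψ, hψ, map_mul, Derivation.leibniz, map_add, smul_eq_mul, smul_eq_mul, map_mul, map_mul,
        RingEquiv.apply_symm_apply, RingEquiv.apply_symm_apply, smul_eq_mul, smul_eq_mul]
  have hD' : ∀ l x, D' l x = φ (D l (φ.symm x)) := fun _ _ => rfl
  refine ⟨fun l => φ (γ l), D', fun l l' => ?_, ?_⟩
  · rw [hD', RingEquiv.symm_apply_apply, hdual]
    split_ifs <;> simp
  · -- `φ(κ^p(γ)) = K^p(φ γ)`
    rw [eq_top_iff]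
    intro y _
    have hx : φ.symm y ∈ pAdjoin p (Set.range γ) := by rw [hgen]; trivial
    have key : ∀ x ∈ pAdjoin p (Set.range γ), φ x ∈ pAdjoin p (Set.range fun l => φ (γ l)) := by
      intro x hx
      unfold pAdjoin at hx ⊢
      induction hx using Subfield.closure_induction with
      | mem z hz =>
        rcases hz with ⟨w, rfl⟩ | ⟨l, rfl⟩
        · refine Subfield.subset_closure (Or.inl ⟨φ w, ?_⟩)
          rw [frobenius_def, frobenius_def, map_pow]
        · exact Subfield.subset_closure (Or.inr ⟨l, rfl⟩)
      | one => rw [map_one]; exact one_mem _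
      | add a b _ _ ha hb => rw [map_add]; exact add_mem ha hb
      | neg a _ ha => rw [map_neg]; exact neg_mem ha
      | inv a _ ha => rw [map_inv₀]; exact inv_mem ha
      | mul a b _ _ ha hb => rw [map_mul]; exact mul_mem ha hb
    simpa using key _ hx

end Frame

/-! ## §2 Transport of isolatedness along an isomorphism of the base -/

section Transport

variable (p : ℕ) [Fact p.Prime] {A A' : Type u} [CommRing A] [CommRing A'] (φ : A ≃+* A') (a : A)

omit [Fact p.Prime] in
/-- `A[T]/(T^p − a) ≅ A'[T]/(T^p − φ a)` along `φ : A ≅ A'` (Mathlib `AdjoinRoot.mapRingEquiv`). [folklore] -/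
theorem nonempty_adjoinRoot_equiv_of_ringEquiv :
    Nonempty (AdjoinRoot ((X : A[X]) ^ p - C a) ≃+* AdjoinRoot ((X : A'[X]) ^ p - C (φ a))) :=
  ⟨AdjoinRoot.mapRingEquiv φ _ _ (by
    rw [Polynomial.map_sub, Polynomial.map_pow, Polynomial.map_X, Polynomial.map_C]
    rfl)⟩

omit [Fact p.Prime] in
/-- **Isolatedness of the `p`-radicand germ is invariant under isomorphisms of the base.** [folklore] -/
theorem isolated_of_ringEquiv
    (hisol : ∀ (P : Ideal (AdjoinRoot ((X : A[X]) ^ p - C a))) [P.IsPrime],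
      (∃ Q : Ideal (AdjoinRoot ((X : A[X]) ^ p - C a)), Q.IsPrime ∧ P < Q) →
        IsRegularLocalRing (Localization.AtPrime P))
    (Q' : Ideal (AdjoinRoot ((X : A'[X]) ^ p - C (φ a)))) [Q'.IsPrime]
    (hQ' : ∃ Q'' : Ideal (AdjoinRoot ((X : A'[X]) ^ p - C (φ a))), Q''.IsPrime ∧ Q' < Q'') :
    IsRegularLocalRing (Localization.AtPrime Q') := by
  obtain ⟨e⟩ := nonempty_adjoinRoot_equiv_of_ringEquiv p φ a
  haveI : (Q'.comap (e : AdjoinRoot ((X : A[X]) ^ p - C a) →+* AdjoinRoot ((X : A'[X]) ^ p - C (φ a)))).IsPrime :=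
    Ideal.comap_isPrime _ _
  have hlt := RadicandAscent.exists_lt_comap_of_exists_lt e hQ'
  have hreg : IsRegularLocalRing (Localization.AtPrime
      (Q'.comap (e : AdjoinRoot ((X : A[X]) ^ p - C a) →+* AdjoinRoot ((X : A'[X]) ^ p - C (φ a))))) :=
    hisol _ hlt
  have hmem : (⟨Q'.comap (e : AdjoinRoot ((X : A[X]) ^ p - C a) →+* AdjoinRoot ((X : A'[X]) ^ p - C (φ a))),
      inferInstance⟩ : PrimeSpectrum (AdjoinRoot ((X : A[X]) ^ p - C a))) ∈ regularLocus _ := by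
    rw [mem_regularLocus]; exact hreg
  have := (mem_regularLocus_iff_of_ringEquiv e ⟨Q', inferInstance⟩).mpr hmem
  rwa [mem_regularLocus] at this

end Transport

/-! ## §3 The Cohen frame of a K(3) member -/

section Cohen

variable (p : ℕ) [Fact p.Prime] (S : Type u) [CommRing S] [IsRegularLocalRing S] [CharP S p]

/-- The completion of a local ring of characteristic `p` has characteristic `p`. [folklore] -/
theorem charP_adicCompletion : CharP (AdicCompletion (maximalIdeal S) S) p :=
  (CharP.charP_iff_prime_eq_zero Fact.out).mpr (by
    rw [← map_natCast (algebraMap S (AdicCompletion (maximalIdeal S) S)) p, CharP.cast_eq_zero, map_zero])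

/-- The residue field of a local ring of characteristic `p` has characteristic `p`. [folklore] -/
theorem charP_residueField {R : Type u} [CommRing R] [IsLocalRing R] [CharP R p] : CharP (ResidueField R) p :=
  (CharP.charP_iff_prime_eq_zero Fact.out).mpr (by
    rw [← map_natCast (IsLocalRing.residue R) p, CharP.cast_eq_zero, map_zero])

/-- The prime field `𝔽_p` inside a ring of characteristic `p` is a subring which is a field (a coefficient subfield
for the Cohen structure theorem). [folklore] -/
theorem isField_range_castHom {R : Type u} [CommRing R] [Nontrivial R] [CharP R p] :
    IsField ((ZMod.castHom (dvd_refl p) R).range) := by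
  have hbij : Function.Bijective (ZMod.castHom (dvd_refl p) R).rangeRestrict :=
    ⟨fun x y h => ZMod.castHom_injective R (congrArg Subtype.val h), RingHom.rangeRestrict_surjective _⟩
  exact MulEquiv.isField (Field.toIsField (ZMod p)) (RingEquiv.ofBijective _ hbij).symm.toMulEquiv

/-- **THE COHEN FRAME OF A K(3) MEMBER (R3c assembled).** Let `S` be a regular local G-ring (e.g. excellent) of
characteristic `p` whose residue field has `p`-rank `e` (`[κ : κ^p] = p^e`), and `f ∈ S` a radicand whose torsor germ
`S[T]/(T^p − f)` has an ISOLATED singularity. Then, with `Ŝ = (S, 𝔪)^`, `K = κ(Ŝ) (≅ κ(S))`, `d = μ(𝔪Ŝ) (= dim S)`: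
there are a Cohen isomorphism `φ : Ŝ ≅ K⟦X₁, …, X_d⟧` and a `p`-basis `γ : Fin e → K` with dual derivations `D` such
that the Jacobian ideal `(∂(φ f̂)/∂X_i, D̃_l (φ f̂))` of the transported radicand lies in NO non-maximal prime of `K⟦X⟧`
(`IsolD` of the Cohen state, prime-wise) — the per-stage static input of the K-side dictionary K3ᴵ, assembled from
`isolated_adicCompletion` (p513029), Matsumura 29.7 (`exists_ringEquiv_mvPowerSeries_residueField`), transport, and the
Jacobian criterion `exists_frame_apply_not_mem_of_isolated` (p511731). The two residue-field `CharP` instances are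
supplied by `charP_residueField` (with `charP_adicCompletion`). OURS (assembly of classical inputs).
[cite: Matsumura1987, Thm. 29.7, Thm. 30.10, §32 p. 256] -/
theorem exists_cohenFrame [CharP (ResidueField S) p] [CharP (ResidueField (AdicCompletion (maximalIdeal S) S)) p]
    (hS : IsGRing S) {e : ℕ}
    (he : Module.finrank (frobenius (ResidueField S) p).fieldRange (ResidueField S) = p ^ e) (f : S)
    (hisol : ∀ (P : Ideal (AdjoinRoot ((X : S[X]) ^ p - C f))) [P.IsPrime],
      (∃ Q : Ideal (AdjoinRoot ((X : S[X]) ^ p - C f)), Q.IsPrime ∧ P < Q) →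
        IsRegularLocalRing (Localization.AtPrime P)) :
    ∃ (φ : AdicCompletion (maximalIdeal S) S ≃+*
        MvPowerSeries (Fin (maximalIdeal (AdicCompletion (maximalIdeal S) S)).spanFinrank)
          (ResidueField (AdicCompletion (maximalIdeal S) S)))
      (γ : Fin e → ResidueField (AdicCompletion (maximalIdeal S) S))
      (D : Fin e → Derivation ℤ (ResidueField (AdicCompletion (maximalIdeal S) S))
        (ResidueField (AdicCompletion (maximalIdeal S) S))),
      (∀ l l', D l (γ l') = if l' = l then 1 else 0) ∧ pAdjoin p (Set.range γ) = ⊤ ∧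
      ∀ (Q : Ideal (MvPowerSeries (Fin (maximalIdeal (AdicCompletion (maximalIdeal S) S)).spanFinrank)
        (ResidueField (AdicCompletion (maximalIdeal S) S)))) [Q.IsPrime], Q ≠ maximalIdeal _ →
        (∃ i, MvPowerSeries.pderiv i (φ (algebraMap S _ f)) ∉ Q) ∨
          ∃ l, (D l).mvPowerSeriesCoeffwise (φ (algebraMap S _ f)) ∉ Q := by
  haveI : IsNoetherianRing (AdicCompletion (maximalIdeal S) S) := isNoetherianRing_adicCompletion_maximalIdeal S
  haveI : IsRegularLocalRing (AdicCompletion (maximalIdeal S) S) := isRegularLocalRing_adicCompletion S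
  haveI : CharP (AdicCompletion (maximalIdeal S) S) p := charP_adicCompletion p S
  -- Cohen: `Ŝ ≅ K⟦X₁, …, X_d⟧` over the coefficient subfield `𝔽_p`
  obtain ⟨φ⟩ := exists_ringEquiv_mvPowerSeries_residueField (AdicCompletion (maximalIdeal S) S)
    (ZMod.castHom (dvd_refl p) (AdicCompletion (maximalIdeal S) S)).range (isField_range_castHom p)
  -- the frame: on `κ(S)` from `[κ : κ^p] = p^e`, transported to `κ(Ŝ) ≅ κ(S)`
  obtain ⟨γ₀, D₀, hdual₀, hgen₀⟩ := exists_frame_card p he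
  let ρ : ResidueField S ≃+* ResidueField (AdicCompletion (maximalIdeal S) S) :=
    RingEquiv.ofBijective _ (AdicCompletion.residueField_map_bijective S)
  obtain ⟨γ, D, hdual, hgen⟩ := exists_frame_of_ringEquiv p ρ γ₀ D₀ hdual₀ hgen₀
  refine ⟨φ, γ, D, hdual, hgen, fun Q _ hQ => ?_⟩
  -- isolatedness: `S ⇒ Ŝ ⇒ K⟦X⟧`, then the Jacobian criterion
  have h1 := RadicandAscent.isolated_adicCompletion p f hS hisol
  have h2 := isolated_of_ringEquiv p φ (algebraMap S (AdicCompletion (maximalIdeal S) S) f) h1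
  exact JacobianCriterionFormal.exists_frame_apply_not_mem_of_isolated p γ D hdual hgen _ h2 Q hQ

/-- The number of Cohen variables is the dimension: `μ(𝔪Ŝ) = dim Ŝ = dim S` for a regular local ring `S`.
[cite: Matsumura1987, §19 p. 158 (proof of Thm. 19.5)] -/
theorem spanFinrank_maximalIdeal_adicCompletion_eq :
    ((maximalIdeal (AdicCompletion (maximalIdeal S) S)).spanFinrank : WithBot ℕ∞) = ringKrullDim S := by
  haveI : IsNoetherianRing (AdicCompletion (maximalIdeal S) S) := isNoetherianRing_adicCompletion_maximalIdeal S
  haveI : IsRegularLocalRing (AdicCompletion (maximalIdeal S) S) := isRegularLocalRing_adicCompletion S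
  rw [← ringKrullDim_adicCompletion S]
  exact (isRegularLocalRing_iff _).mp inferInstance

end Cohen

end Summit.ResolutionOfSingularities.ResolutionOfSingularities.Theorems.SwitchingDichotomy.RadicandCohenFrame

end
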